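import Literature.Computability.Complexity.OracleClosure
import HarnessLib

/-!
# Composition of oracle algorithms in the transcript model (`P^{FP^O} ⊆ P^O`)

Trunk `CplxCore`, companion of `Oracle.lean` and `OracleClosure.lean` (G01: oracle algorithms as *step functions*
`(input, answers so far) ↦ next query | output`, classes `PRel O = P^O`, `FPRel O = FP^O`).
The textbook fact "polynomial-time oracle machines compose" — if `f ∈ FP^O` then
`P^f ⊆ P^O` and `FP^f ⊆ FP^O`, in particular `P^{P^O} = P^O` and `≤ᵀₚ` is transitive
(Ladner–Lynch–Selman 1975, §2: "answer each query of the first procedure by running the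
second"; Arora–Barak 2009, §3.4 with Claim 1.6) — is, in the transcript model, a genuine
machine construction: the composite step function must *replay*, from the input `x` and the
answers of `O` received so far, the run of the outer algorithm `M`, answering each of its
queries `u` by replaying the inner algorithm `N` on `u`, and it must do so in time polynomial in
the length of its own input `⟨x, answers⟩`. This file carries out the replay and its
correctness proof; the polynomial running time of the resulting step function is isolated as
ONE named machine fact (`OracleAlg.isPolyTime_compose`, discharged separately from the tree's
`FinTM2` toolkit), from which the closure theorems follow here.

## Contents

* `OracleAlg.exists_trace_of_runAux`, `OracleAlg.runAux_of_trace` — a successful fuelled run is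
  the same thing as a *trace*: queries `us` such that after the answers to `us[0..i)` the step
  function asks `us[i]` and after all of them it outputs (`queriesAux = us`).
* `OracleComposition.State`, `stepM`, `stepN`, `G = GN ∘ GM`, `initState`, `readout`,
  `compose M N eb prm : OracleAlg β` — the composite machine as a clocked iteration of a
  micro-step on a typed state (phase; transcript `fAns` of `M`; current query `u` and
  transcript `nAns` of `N`; unconsumed answers `rest`; pending query `out`; clamp bound `bnd`
  and fuel `pad`). Strings produced by the simulated step functions are clamped to `bnd` and
  every active half-step costs one unit of fuel — this is what makes the micro-step
  length-non-increasing on a padded tape, hence iterable in polynomial time; on genuine runs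
  the clamps are inactive (`Params`: resource functions of the input length).
* `readout_iterate_G` (main simulation theorem), `compose_step_eq`, `compose_runAux_eq` — with
  `Q = us.flatMap (N.queries O kN ·)` the global sequence of queries to `O`: on the answers to
  `Q[0..j)` the composite step function reports `Q[j]` (or the output of `M` when `j = |Q|`);
  hence `compose` run with oracle `O` returns `M`'s output with oracle `f` and has transcript
  `Q`.
* `OracleAlg.isPolyTime_compose` (named fact, `def … : Prop`) and, conditional on it,
  `exists_polyTime_of_mem_FPRel` (master form with the polynomial bookkeeping),
  `PRel_subset_PRel_of_mem_FPRel_of` (`f ∈ FP^O ⟹ P^f ⊆ P^O`),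
  `FPRel_subset_FPRel_of_mem_FPRel_of`, `mem_PRel_of_polyTimeTuringReducible_of`
  (`P^{P^O} = P^O`, the named fact of `Oracle.lean`), `polyTimeTuringReducible_trans_of`.
* Auxiliary: `OracleAlg.mapOut` (re-presenting outputs; `ofLanguage_mem_FPRel_of_mem_PRel`:
  the oracle of a `P^O` language is an `FP^O` function), length of the `listBool` code.

## Design notes

* The micro-step runs *both* halves `GM`, `GN` unconditionally (each is the identity outside its
  phase); this mirrors the machine, which runs both black-box step functions in every round.
* `stepM` on an output `b` tests `|eb.encode b| ≤ bnd` (and abandons otherwise) instead of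
  clamping, because a truncated code is not a code; on genuine runs the test passes.
* Resource parameters are functions of `n = |boolPair x (listBool.encode answers)|` only
  (`inputLength`); the bounds needed on genuine runs (`exists_polyTime_of_mem_FPRel`) are
  polynomial in `n` because the answers fed to `N` on a completed query are among the answers
  received (`sublist_take_flatMap`, `length_listBool_encode_le_of_sublist`) and a
  polynomial-time step function has polynomially long output
  (`OracleAlg.IsPolyTime.exists_length_le`).

## References

* R. E. Ladner, N. A. Lynch, A. L. Selman, *A comparison of polynomial time reducibilities*,
  Theoret. Comput. Sci. 1 (1975) 103–123, §2 (Prop. 2.1: `≤ᵀᴾ` is transitive; "routine").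
* S. Arora, B. Barak, *Computational Complexity: A Modern Approach*, CUP 2009, §3.4 (oracle
  machines), Claim 1.6 and proof of Thm. 2.8 (polynomial-time computations compose), §17.2
  (`FP^{#P}`).
* T. Baker, J. Gill, R. Solovay, *Relativizations of the P =? NP question*, SIAM J. Comput. 4
  (1975), §1.
-/

namespace Literature.Computability.Complexity

open _root_.Computability

namespace OracleAlg

variable {β : Type}

/-! ### Traces of fuelled runs -/

/-- **Trace of a successful run.** If `M.runAux O x k pre = some b` then the run asks a list of
queries `us` (its transcript `M.queriesAux O x k pre`), of length `< k`; after the answers to the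
first `i` of them the step function asks `us[i]`, and after all answers it outputs `b`.
[Arora–Barak 2009, §3.4 (configurations of an oracle machine are determined by the input and
the answers)] [cite: AroraBarak2009, §3.4] -/
theorem exists_trace_of_runAux (M : OracleAlg β) (O : Oracle) (x : List Bool) :
    ∀ (k : ℕ) (pre : List (List Bool)) (b : β), M.runAux O x k pre = some b →
      ∃ us : List (List Bool), us.length < k ∧
        (∀ (i : ℕ) (hi : i < us.length),
          M.step x (pre ++ (us.take i).map O) = Sum.inl (us[i])) ∧
        M.step x (pre ++ us.map O) = Sum.inr b ∧ M.queriesAux O x k pre = us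
  | 0, pre, b, h => by simp at h
  | k + 1, pre, b, h => by
    rw [runAux_succ] at h
    cases hs : M.step x pre with
    | inr b' =>
      rw [hs] at h
      simp only [Option.some.injEq] at h
      subst h
      refine ⟨[], by simp, fun i hi => by simp at hi, by simpa using hs, ?_⟩
      simp [queriesAux, hs]
    | inl q =>
      rw [hs] at h
      obtain ⟨us, hlen, hstep, hout, hq⟩ := exists_trace_of_runAux M O x k (pre ++ [O q]) b h
      refine ⟨q :: us, by simpa using hlen, fun i hi => ?_, by simpa using hout, ?_⟩
      · cases i with
        | zero => simpa using hs
        | succ i =>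
          have hi' : i < us.length := by simpa using hi
          simpa [List.take_succ_cons, List.append_assoc] using hstep i hi'
      · simp [queriesAux, hs, hq]

/-- **A trace determines the run.** Conversely, if after the answers to the first `i` queries of
`us` the step function asks `us[i]` and after all of them it outputs `b`, then any run with fuel
`> |us|` returns `b` and its transcript is `us`. [Arora–Barak 2009, §3.4] [cite: AroraBarak2009, §3.4] -/
theorem runAux_of_trace (M : OracleAlg β) (O : Oracle) (x : List Bool) :
    ∀ (us : List (List Bool)) (pre : List (List Bool)) (b : β) (k : ℕ),
      (∀ (i : ℕ) (hi : i < us.length),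
          M.step x (pre ++ (us.take i).map O) = Sum.inl (us[i])) →
      M.step x (pre ++ us.map O) = Sum.inr b → us.length < k →
        M.runAux O x k pre = some b ∧ M.queriesAux O x k pre = us
  | us, pre, b, 0, _, _, hk => by simp at hk
  | [], pre, b, k + 1, _, hout, _ => by
    have hs : M.step x pre = Sum.inr b := by simpa using hout
    simp [runAux_succ, queriesAux, hs]
  | q :: us, pre, b, k + 1, hstep, hout, hk => by
    have hs : M.step x pre = Sum.inl q := by
      have h0 := hstep 0 (by simp)
      rw [List.getElem_cons_zero] at h0
      simpa using h0
    have ih := runAux_of_trace M O x us (pre ++ [O q]) b k (fun i hi => by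
      have h1 := hstep (i + 1) (by simpa using hi)
      rw [List.getElem_cons_succ] at h1
      simpa [List.take_succ_cons, List.append_assoc] using h1)
      (by simpa using hout) (by simpa using hk)
    simp [runAux_succ, queriesAux, hs, ih.1, ih.2]

end OracleAlg

/-! ### The composite machine: typed state and micro-step -/

namespace OracleComposition

variable {β : Type}

/-- Control phase of the composite machine: simulating a step of the outer algorithm `M`
(`runM`), simulating the inner algorithm `N` on the current query of `M` (`runN`), finished
with a pending query to the oracle (`doneQuery`, the query is the field `out`), or finished with
the output `b` of `M` (`doneOut b`). [folklore] -/
inductive Phase (β : Type)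
  | runM
  | runN
  | doneQuery
  | doneOut (b : β)

/-- State of the composite machine between micro-steps: phase; input `x` and the answers
`fAns` of the intermediate oracle `f` obtained so far (the transcript of `M`); the current query
`u` of `M` and the answers `nAns` of `O` fed to `N` on it so far (the transcript of `N`); the
answers `rest` of `O` not yet consumed; the pending query `out`; the clamp bound `bnd` and the
fuel `pad` (number of micro-steps still paid for). [folklore] -/
structure State (β : Type) where
  /-- control phase -/
  phase : Phase β
  /-- the input of the outer algorithm -/
  x : List Bool
  /-- answers of the intermediate oracle received by the outer algorithm so far -/
  fAns : List (List Bool)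
  /-- the current query of the outer algorithm (input of the inner algorithm) -/
  u : List Bool
  /-- answers of the oracle fed to the inner algorithm on the current query so far -/
  nAns : List (List Bool)
  /-- answers of the oracle not yet consumed -/
  rest : List (List Bool)
  /-- the pending query to the oracle -/
  out : List Bool
  /-- clamp bound: longer strings produced by the simulated machines are truncated -/
  bnd : ℕ
  /-- fuel: number of simulated steps still paid for -/
  pad : ℕ

variable (M : OracleAlg β) (N : OracleAlg (List Bool)) (eb : Encoding β Bool)

/-- Effect of one step of the outer algorithm with result `r` (in phase `runM`, if fuel is
left): a query `q` becomes the current query (clamped to `bnd`) and the phase becomes `runN`;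
an output `b` ends the computation (`doneOut b`) provided its code has length `≤ bnd`
(otherwise the computation is abandoned in phase `doneQuery`). [folklore] -/
def stepM (s : State β) (r : List Bool ⊕ β) : State β :=
  match s.phase, s.pad with
  | .runM, p + 1 =>
    match r with
    | .inl q => { s with phase := .runN, u := q.take s.bnd, nAns := [], pad := p }
    | .inr b =>
      if (eb.encode b).length ≤ s.bnd then { s with phase := .doneOut b, pad := p }
      else { s with phase := .doneQuery, pad := p }
  | _, _ => s

/-- Effect of one step of the inner algorithm with result `r` (in phase `runN`, if fuel is
left): an output `y` is the answer of the intermediate oracle to the current query — it is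
appended (clamped) to `fAns` and the phase returns to `runM`; a query `q` is answered by the next
unconsumed answer of `rest` if there is one, and otherwise becomes the pending query (`doneQuery`).
[folklore] -/
def stepN (s : State β) (r : List Bool ⊕ List Bool) : State β :=
  match s.phase, s.pad with
  | .runN, p + 1 =>
    match r with
    | .inr y =>
      { s with phase := .runM, fAns := s.fAns ++ [y.take s.bnd], u := [], nAns := [], pad := p }
    | .inl q =>
      match s.rest with
      | a :: rest' => { s with nAns := s.nAns ++ [a], rest := rest', pad := p }
      | [] => { s with phase := .doneQuery, out := q.take s.bnd, pad := p }
  | _, _ => s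

/-- The `M`-half of a micro-step: run the step function of `M` on its transcript. [folklore] -/
def GM (s : State β) : State β :=
  stepM eb s (M.step s.x s.fAns)

/-- The `N`-half of a micro-step: run the step function of `N` on its transcript. [folklore] -/
def GN (s : State β) : State β :=
  stepN s (N.step s.u s.nAns)

/-- One micro-step of the composite machine: an `M`-half followed by an `N`-half. [folklore] -/
def G (s : State β) : State β :=
  GN N (GM M eb s)

/-- Reading the result off the final state: the output of `M`, or else the pending query.
[folklore] -/
def readout (s : State β) : List Bool ⊕ β :=
  match s.phase with
  | .doneOut b => .inr b
  | _ => .inl s.out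

/-- Resource parameters of the composite machine, as functions of the length of its encoded
input `⟨x, answers⟩`: clamp bound, fuel, number of micro-steps. [folklore] -/
structure Params where
  /-- clamp bound -/
  bndOf : ℕ → ℕ
  /-- fuel (number of paid half-steps) -/
  padOf : ℕ → ℕ
  /-- number of micro-steps executed -/
  iterOf : ℕ → ℕ

/-- Length of the encoded input `boolPair x (listBool.encode answers)` of a step function.
[folklore] -/
def inputLength (x : List Bool) (ans : List (List Bool)) : ℕ :=
  (boolPair x ((encodingList Bool).listBool.encode ans)).length

/-- Initial state on step-function input `(x, answers)`. [folklore] -/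
def initState (prm : Params) (x : List Bool) (ans : List (List Bool)) : State β where
  phase := .runM
  x := x
  fAns := []
  u := []
  nAns := []
  rest := ans
  out := []
  bnd := prm.bndOf (inputLength x ans)
  pad := prm.padOf (inputLength x ans)

/-- **The composite oracle algorithm** `M ∘ N`: its step function replays, from the input `x`
and the answers of `O` received so far, the computation of `M` in which every query `u` to the
intermediate oracle is answered by running `N` on `u` with oracle `O`; it reports the first
query of `N` whose answer is not yet available, or the output of `M`.
[Arora–Barak 2009, §3.4; Ladner–Lynch–Selman 1975, §2 (transitivity of `≤ᵀᴾ`)]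
[cite: LadnerLynchSelman1975, §2] -/
def compose (prm : Params) : OracleAlg β where
  step x ans := readout ((G M N eb)^[prm.iterOf (inputLength x ans)] (initState prm x ans))

/-! ### Elementary properties of the micro-step -/

section Basic

variable {M N eb}

/-- Outside phase `runM` the `M`-half is the identity (phase `runN`). [folklore] -/
@[simp] theorem GM_of_runN (s : State β) (h : s.phase = .runN) : GM M eb s = s := by
  simp [GM, stepM, h]

/-- The `M`-half is the identity in phase `doneQuery`. [folklore] -/
@[simp] theorem GM_of_doneQuery (s : State β) (h : s.phase = .doneQuery) : GM M eb s = s := by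
  simp [GM, stepM, h]

/-- The `M`-half is the identity in phase `doneOut`. [folklore] -/
@[simp] theorem GM_of_doneOut (s : State β) (b : β) (h : s.phase = .doneOut b) :
    GM M eb s = s := by
  simp [GM, stepM, h]

/-- Outside phase `runN` the `N`-half is the identity (phase `runM`). [folklore] -/
@[simp] theorem GN_of_runM (s : State β) (h : s.phase = .runM) : GN N s = s := by
  simp [GN, stepN, h]

/-- The `N`-half is the identity in phase `doneQuery`. [folklore] -/
@[simp] theorem GN_of_doneQuery (s : State β) (h : s.phase = .doneQuery) : GN N s = s := by
  simp [GN, stepN, h]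

/-- The `N`-half is the identity in phase `doneOut`. [folklore] -/
@[simp] theorem GN_of_doneOut (s : State β) (b : β) (h : s.phase = .doneOut b) : GN N s = s := by
  simp [GN, stepN, h]

/-- A finished machine idles (phase `doneQuery`). [folklore] -/
theorem G_of_doneQuery (s : State β) (h : s.phase = .doneQuery) : G M N eb s = s := by
  simp [G, h]

/-- A finished machine idles (phase `doneOut`). [folklore] -/
theorem G_of_doneOut (s : State β) (b : β) (h : s.phase = .doneOut b) : G M N eb s = s := by
  simp [G, GM_of_doneOut s b h, GN_of_doneOut s b h]

/-- A finished machine idles forever (phase `doneQuery`). [folklore] -/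
theorem iterate_G_of_doneQuery (s : State β) (h : s.phase = .doneQuery) (n : ℕ) :
    (G M N eb)^[n] s = s := by
  induction n with
  | zero => rfl
  | succ n ih => rw [Function.iterate_succ_apply, G_of_doneQuery s h, ih]

/-- A finished machine idles forever (phase `doneOut`). [folklore] -/
theorem iterate_G_of_doneOut (s : State β) (b : β) (h : s.phase = .doneOut b) (n : ℕ) :
    (G M N eb)^[n] s = s := by
  induction n with
  | zero => rfl
  | succ n ih => rw [Function.iterate_succ_apply, G_of_doneOut s b h, ih]

end Basic

/-! ### Simulation of one query of `M`: the `N`-phase -/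

section Simulation

variable {M N eb} (O : Oracle)

/-- In phase `runN` with fuel left, a micro-step is an `N`-half. [folklore] -/
theorem G_eq_stepN (s : State β) (h : s.phase = .runN) :
    G M N eb s = stepN s (N.step s.u s.nAns) := by
  simp [G, GM_of_runN s h, GN]

/-- **The `N`-phase, complete case.** If `N` on the current query `u`, after the answers to the
first `j` of its queries `vs`, asks `vs[j]`, …, and after all of them outputs `y`, and the
unconsumed answers start with the answers to `vs[j], vs[j+1], …`, then after `|vs| - j + 1`
micro-steps the answer `y` has been appended to the transcript of `M` and the phase is `runM`
again. [Arora–Barak 2009, §3.4] [cite: AroraBarak2009, §3.4] -/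
theorem iterate_G_runN (u y : List Bool) (vs rest' : List (List Bool))
    (hv : ∀ (j : ℕ) (hj : j < vs.length), N.step u ((vs.take j).map O) = Sum.inl (vs[j]))
    (hvo : N.step u (vs.map O) = Sum.inr y) :
    ∀ (d : ℕ) (s : State β) (j : ℕ), j + d = vs.length → s.phase = .runN → s.u = u →
      s.nAns = (vs.take j).map O → s.rest = (vs.drop j).map O ++ rest' → d + 1 ≤ s.pad →
      y.length ≤ s.bnd →
      (G M N eb)^[d + 1] s =
        { s with phase := .runM, fAns := s.fAns ++ [y], u := [], nAns := [], rest := rest',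
                 pad := s.pad - (d + 1) }
  | 0, ⟨ph, x, fAns, u₀, nAns, rest, out, bnd, pad⟩, j, hjd, hph, hu, hn, hr, hpad, hy => by
    simp only at hph hu hn hr hpad hy ⊢
    obtain ⟨p, rfl⟩ : ∃ p, pad = p + 1 := ⟨pad - 1, by omega⟩
    have hj : j = vs.length := by omega
    subst hj ph u₀ nAns rest
    rw [Function.iterate_one, G_eq_stepN _ rfl]
    simp [stepN, hvo, List.take_of_length_le hy]
  | d + 1, ⟨ph, x, fAns, u₀, nAns, rest, out, bnd, pad⟩, j, hjd, hph, hu, hn, hr, hpad, hy => by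
    simp only at hph hu hn hr hpad hy ⊢
    obtain ⟨p, rfl⟩ : ∃ p, pad = p + 1 := ⟨pad - 1, by omega⟩
    subst ph u₀ nAns rest
    have hj : j < vs.length := by omega
    have hdrop : vs.drop j = vs[j] :: vs.drop (j + 1) := (List.getElem_cons_drop hj).symm
    -- the first micro-step consumes the answer to `vs[j]`
    have h1 : G M N eb ⟨.runN, x, fAns, u, (vs.take j).map O, (vs.drop j).map O ++ rest', out, bnd,
          p + 1⟩ =
        ⟨.runN, x, fAns, u, (vs.take (j + 1)).map O, (vs.drop (j + 1)).map O ++ rest', out, bnd,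
          p⟩ := by
      rw [G_eq_stepN _ rfl]
      simp only
      rw [hv j hj, hdrop, List.map_cons, List.cons_append, List.take_succ_eq_append_getElem hj,
        List.map_append, List.map_singleton]
      simp only [stepN]
    rw [Function.iterate_succ_apply, h1,
      iterate_G_runN u y vs rest' hv hvo d _ (j + 1) (by omega) rfl rfl rfl rfl
        (by simp only; omega) hy]
    simp only [State.mk.injEq, true_and]
    omega

/-- **Processing one query of `M` completely.** In phase `runM` with the step function of `M`
asking `u` (of length `≤ bnd`), if `N` on `u` asks the queries `vs` and then outputs `y` (of
length `≤ bnd`) and the unconsumed answers start with the answers to `vs`, then after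
`|vs| + 1` micro-steps `y` has been appended to the transcript of `M`, the answers to `vs` are
consumed, `|vs| + 2` units of fuel are spent, and the phase is `runM` again.
[Arora–Barak 2009, §3.4; Ladner–Lynch–Selman 1975, §2] [cite: LadnerLynchSelman1975, §2] -/
theorem iterate_G_query (s : State β) (u y : List Bool) (vs rest' : List (List Bool))
    (hM : M.step s.x s.fAns = Sum.inl u) (hu : u.length ≤ s.bnd)
    (hv : ∀ (j : ℕ) (hj : j < vs.length), N.step u ((vs.take j).map O) = Sum.inl (vs[j]))
    (hvo : N.step u (vs.map O) = Sum.inr y) (hy : y.length ≤ s.bnd)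
    (hph : s.phase = .runM) (hr : s.rest = vs.map O ++ rest') (hpad : vs.length + 2 ≤ s.pad) :
    (G M N eb)^[vs.length + 1] s =
      { s with fAns := s.fAns ++ [y], u := [], nAns := [], rest := rest',
               pad := s.pad - (vs.length + 2) } := by
  obtain ⟨ph, x, fAns, u₀, nAns, rest, out, bnd, pad⟩ := s
  simp only at hM hu hy hph hr hpad ⊢
  obtain ⟨p, rfl⟩ : ∃ p, pad = p + 1 + 1 := ⟨pad - 2, by omega⟩
  subst ph rest
  -- the `M`-half of the first micro-step
  have hGM : GM M eb ⟨.runM, x, fAns, u₀, nAns, vs.map O ++ rest', out, bnd, p + 1 + 1⟩ =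
      ⟨.runN, x, fAns, u, [], vs.map O ++ rest', out, bnd, p + 1⟩ := by
    simp [GM, hM, stepM, List.take_of_length_le hu]
  rw [Function.iterate_succ_apply, G, hGM]
  cases vs with
  | nil =>
    have hvo' : N.step u [] = Sum.inr y := by simpa using hvo
    simp [GN, hvo', stepN, List.take_of_length_le hy]
  | cons v vs' =>
    simp only [List.length_cons] at hpad ⊢
    have hv0 : N.step u [] = Sum.inl v := by
      have := hv 0 (by simp)
      rw [List.getElem_cons_zero] at this
      simpa using this
    have hGN : GN N (⟨.runN, x, fAns, u, [], (v :: vs').map O ++ rest', out, bnd, p + 1⟩ : State β) =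
        ⟨.runN, x, fAns, u, [O v], vs'.map O ++ rest', out, bnd, p⟩ := by
      simp [GN, hv0, stepN]
    rw [hGN,
      iterate_G_runN (M := M) (eb := eb) O u y (v :: vs') rest' hv hvo vs'.length _ 1
        (by simp only [List.length_cons]; omega) rfl rfl (by simp) (by simp) (by simp only; omega) hy]
    simp only [State.mk.injEq, true_and]
    omega

/-- **The `N`-phase, incomplete case.** If the unconsumed answers are exactly the answers to
`vs[j₀], …, vs[j-1]` with `j < |vs|`, then after `j - j₀ + 1` micro-steps the machine stops
with the pending query `vs[j]`. [Arora–Barak 2009, §3.4] [cite: AroraBarak2009, §3.4] -/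
theorem iterate_G_runN_partial (u : List Bool) (vs : List (List Bool)) (j : ℕ)
    (hj : j < vs.length)
    (hv : ∀ (j : ℕ) (hj : j < vs.length), N.step u ((vs.take j).map O) = Sum.inl (vs[j])) :
    ∀ (d : ℕ) (s : State β) (j₀ : ℕ), j₀ + d = j → s.phase = .runN → s.u = u →
      s.nAns = (vs.take j₀).map O → s.rest = ((vs.take j).drop j₀).map O → d + 1 ≤ s.pad →
      (vs[j]).length ≤ s.bnd →
      ∃ s' : State β, (G M N eb)^[d + 1] s = s' ∧ s'.phase = .doneQuery ∧ s'.out = vs[j]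
  | 0, ⟨ph, x, fAns, u₀, nAns, rest, out, bnd, pad⟩, j₀, hjd, hph, hu, hn, hr, hpad, hqb => by
    simp only at hph hu hn hr hpad hqb ⊢
    obtain ⟨p, rfl⟩ : ∃ p, pad = p + 1 := ⟨pad - 1, by omega⟩
    have hj₀ : j₀ = j := by omega
    subst hj₀ ph u₀ nAns rest
    refine ⟨_, rfl, ?_, ?_⟩ <;>
    · rw [Function.iterate_one, G_eq_stepN _ rfl]
      simp only
      rw [hv j₀ hj]
      simp [stepN, List.take_of_length_le hqb]
  | d + 1, ⟨ph, x, fAns, u₀, nAns, rest, out, bnd, pad⟩, j₀, hjd, hph, hu, hn, hr, hpad, hqb => by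
    simp only at hph hu hn hr hpad hqb ⊢
    obtain ⟨p, rfl⟩ : ∃ p, pad = p + 1 := ⟨pad - 1, by omega⟩
    subst ph u₀ nAns rest
    have hj₀ : j₀ < j := by omega
    have hj₀' : j₀ < vs.length := by omega
    have hlen : j₀ < (vs.take j).length := by simp; omega
    have hdrop : (vs.take j).drop j₀ = vs[j₀] :: (vs.take j).drop (j₀ + 1) := by
      rw [← List.getElem_cons_drop hlen, List.getElem_take]
    have h1 : G M N eb ⟨.runN, x, fAns, u, (vs.take j₀).map O, ((vs.take j).drop j₀).map O, out,
          bnd, p + 1⟩ =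
        ⟨.runN, x, fAns, u, (vs.take (j₀ + 1)).map O, ((vs.take j).drop (j₀ + 1)).map O, out,
          bnd, p⟩ := by
      rw [G_eq_stepN _ rfl]
      simp only
      rw [hv j₀ hj₀', hdrop, List.map_cons, List.take_succ_eq_append_getElem hj₀', List.map_append,
        List.map_singleton]
      simp only [stepN]
    rw [Function.iterate_succ_apply, h1]
    exact iterate_G_runN_partial u vs j hj hv d _ (j₀ + 1) (by omega) rfl rfl rfl rfl
      (by simp only; omega) hqb

/-- **Processing one query of `M`, incomplete case.** In phase `runM` with `M` asking `u`, if
the unconsumed answers are exactly the answers to the first `j < |vs|` queries of `N` on `u`,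
then after `j + 1` micro-steps the machine stops with the pending query `vs[j]`.
[Arora–Barak 2009, §3.4] [cite: AroraBarak2009, §3.4] -/
theorem iterate_G_query_partial (s : State β) (u : List Bool) (vs : List (List Bool)) (j : ℕ)
    (hj : j < vs.length) (hM : M.step s.x s.fAns = Sum.inl u) (hu : u.length ≤ s.bnd)
    (hv : ∀ (j : ℕ) (hj : j < vs.length), N.step u ((vs.take j).map O) = Sum.inl (vs[j]))
    (hph : s.phase = .runM) (hr : s.rest = (vs.take j).map O) (hpad : j + 2 ≤ s.pad)
    (hqb : (vs[j]).length ≤ s.bnd) :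
    ∃ s' : State β, (G M N eb)^[j + 1] s = s' ∧ s'.phase = .doneQuery ∧ s'.out = vs[j] := by
  obtain ⟨ph, x, fAns, u₀, nAns, rest, out, bnd, pad⟩ := s
  simp only at hM hu hph hr hpad hqb ⊢
  obtain ⟨p, rfl⟩ : ∃ p, pad = p + 1 + 1 := ⟨pad - 2, by omega⟩
  subst ph rest
  have hGM : GM M eb ⟨.runM, x, fAns, u₀, nAns, (vs.take j).map O, out, bnd, p + 1 + 1⟩ =
      ⟨.runN, x, fAns, u, [], (vs.take j).map O, out, bnd, p + 1⟩ := by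
    simp [GM, hM, stepM, List.take_of_length_le hu]
  rw [Function.iterate_succ_apply, G, hGM]
  cases vs with
  | nil => simp at hj
  | cons v vs' =>
    have hv0 : N.step u [] = Sum.inl v := by
      have := hv 0 (by simp)
      rw [List.getElem_cons_zero] at this
      simpa using this
    cases j with
    | zero =>
      rw [List.getElem_cons_zero] at hqb ⊢
      refine ⟨_, rfl, ?_, ?_⟩ <;>
        simp [GN, hv0, stepN, List.take_of_length_le hqb]
    | succ j' =>
      have hGN : GN N (⟨.runN, x, fAns, u, [], ((v :: vs').take (j' + 1)).map O, out, bnd, p + 1⟩ :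
            State β) =
          ⟨.runN, x, fAns, u, [O v], (vs'.take j').map O, out, bnd, p⟩ := by
        simp [GN, hv0, stepN, List.take_succ_cons]
      rw [hGN]
      exact iterate_G_runN_partial (M := M) (N := N) (eb := eb) O u (v :: vs') (j' + 1) hj hv
        j' _ 1 (by omega) rfl rfl (by simp) (by simp [List.take_succ_cons]) (by simp only; omega)
        hqb

/-- **The output step.** In phase `runM` with fuel left, if the step function of `M` outputs `b`
(with code of length `≤ bnd`), one micro-step ends the computation in phase `doneOut b`.
[Arora–Barak 2009, §3.4] [cite: AroraBarak2009, §3.4] -/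
theorem G_output (s : State β) (b : β) (hM : M.step s.x s.fAns = Sum.inr b)
    (hph : s.phase = .runM) (hpad : 1 ≤ s.pad) (hb : (eb.encode b).length ≤ s.bnd) :
    (G M N eb s).phase = .doneOut b := by
  obtain ⟨ph, x, fAns, u₀, nAns, rest, out, bnd, pad⟩ := s
  simp only at hM hph hpad hb ⊢
  obtain ⟨p, rfl⟩ : ∃ p, pad = p + 1 := ⟨pad - 1, by omega⟩
  subst ph
  have hGM : GM M eb ⟨.runM, x, fAns, u₀, nAns, rest, out, bnd, p + 1⟩ =
      ⟨.doneOut b, x, fAns, u₀, nAns, rest, out, bnd, p⟩ := by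
    simp [GM, hM, stepM, if_pos hb]
  rw [G, hGM, GN_of_doneOut _ b rfl]

end Simulation

/-! ### The composite step function replays `M`, with `N` answering its queries -/

section Spec

variable {M N eb} (O f : Oracle) (kN : ℕ)

/-- **Main simulation theorem.** Suppose that, after the answers (by `f`) to the first `i` of
the queries `us`, the outer step function asks `us[i]`, and after all of them outputs `b`; that
`N` with oracle `O` computes `f u` within `kN` rounds on every `u ∈ us`, asking the queries
`N.queries O kN u`; and that the clamp bound dominates all these strings. Let
`Q = us.flatMap (N.queries O kN ·)` be the resulting global sequence of queries to `O`. Then,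
started in phase `runM` with transcript `pre` and with the answers to the first `j ≤ |Q|`
queries of `Q` available, and given enough fuel and micro-steps, the machine ends reporting the
query `Q[j]` if `j < |Q|` and the output `b` if `j = |Q|`.
[Arora–Barak 2009, §3.4; Ladner–Lynch–Selman 1975, §2 (transitivity of `≤ᵀᴾ`: "answer each
query of the first machine by running the second")] [cite: LadnerLynchSelman1975, §2] -/
theorem readout_iterate_G (x : List Bool) (b : β) :
    ∀ (us pre : List (List Bool)) (s : State β) (j T : ℕ),
      (∀ (i : ℕ) (hi : i < us.length), M.step x (pre ++ (us.take i).map f) = Sum.inl (us[i])) →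
      M.step x (pre ++ us.map f) = Sum.inr b →
      (∀ u ∈ us, N.run O kN u = some (f u)) →
      (∀ u ∈ us, u.length ≤ s.bnd) →
      (∀ u ∈ us, ∀ q ∈ N.queries O kN u, q.length ≤ s.bnd) →
      (∀ (i : ℕ) (hi : i < us.length),
        ((us.take (i + 1)).map fun u => (N.queries O kN u).length).sum ≤ j →
          (f (us[i])).length ≤ s.bnd) →
      (((us.map fun u => (N.queries O kN u).length).sum ≤ j) → (eb.encode b).length ≤ s.bnd) →
      s.phase = .runM → s.x = x → s.fAns = pre →
      s.rest = ((us.flatMap fun u => N.queries O kN u).take j).map O →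
      j ≤ (us.flatMap fun u => N.queries O kN u).length →
      (us.map fun u => (N.queries O kN u).length + 2).sum + 1 ≤ s.pad →
      (us.map fun u => (N.queries O kN u).length + 1).sum + 1 ≤ T →
      readout ((G M N eb)^[T] s) =
        if h : j < (us.flatMap fun u => N.queries O kN u).length then
          Sum.inl ((us.flatMap fun u => N.queries O kN u)[j]) else Sum.inr b
  | [], pre, s, j, T, _, hout, _, _, _, _, hb, hph, hx, hf, hr, hj, hpad, hT => by
    simp only [List.flatMap_nil, List.length_nil, Nat.le_zero] at hj
    subst hj
    obtain ⟨T', rfl⟩ : ∃ T', T = T' + 1 := ⟨T - 1, by simp at hT; omega⟩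
    have hM : M.step s.x s.fAns = Sum.inr b := by rw [hx, hf]; simpa using hout
    have hdone := G_output (N := N) s b hM hph (by simp at hpad; omega) (hb (by simp))
    rw [Function.iterate_succ_apply, iterate_G_of_doneOut _ b hdone]
    simp [readout, hdone]
  | u :: us', pre, s, j, T, hstep, hout, hN, hub, hqb, hfb, hb, hph, hx, hf, hr, hj, hpad, hT => by
    -- the trace of `N` on `u`
    obtain ⟨vs, -, hv, hvo, hvs⟩ :=
      N.exists_trace_of_runAux O u kN [] (f u) (hN u (by simp))
    simp only [List.nil_append] at hv hvo
    have hq : N.queries O kN u = vs := hvs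
    simp only [List.flatMap_cons, List.map_cons, List.sum_cons, hq, List.length_append]
      at hr hj hpad hT ⊢
    -- the outer machine asks `u`
    have hM : M.step s.x s.fAns = Sum.inl u := by
      have h0 := hstep 0 (by simp)
      rw [List.getElem_cons_zero] at h0
      rw [hx, hf]; simpa using h0
    have hu := hub u (by simp)
    have hqs := hqb u (by simp)
    rw [hq] at hqs
    by_cases hjv : j < vs.length
    · -- the available answers run out while `N` works on `u`: pending query `vs[j]`
      have hr' : s.rest = (vs.take j).map O := by
        rw [hr, List.take_append_of_le_length hjv.le]
      obtain ⟨s', hs', hph', hout'⟩ := iterate_G_query_partial O s u vs j hjv hM hu hv hph hr'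
        (by omega) (hqs _ (List.getElem_mem hjv))
      obtain ⟨T', rfl⟩ : ∃ T', T = T' + (j + 1) := ⟨T - (j + 1), by omega⟩
      rw [Function.iterate_add_apply, hs', iterate_G_of_doneQuery s' hph',
        dif_pos (by omega)]
      simp [readout, hph', hout', List.getElem_append_left hjv]
    · -- `N` finishes on `u`: the answer `f u` is appended and the simulation continues
      push Not at hjv
      have hfu : (f u).length ≤ s.bnd := by
        have := hfb 0 (by simp) (by simpa [hq] using hjv)
        rwa [List.getElem_cons_zero] at this
      have hr' : s.rest = vs.map O ++
          (((us'.flatMap fun u => N.queries O kN u).take (j - vs.length)).map O) := by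
        rw [hr, List.take_append, List.take_of_length_le hjv, List.map_append]
      have hA := iterate_G_query (eb := eb) O s u (f u) vs _ hM hu hv hvo hfu hph hr' (by omega)
      obtain ⟨T', rfl⟩ : ∃ T', T = T' + (vs.length + 1) := ⟨T - (vs.length + 1), by omega⟩
      rw [Function.iterate_add_apply, hA]
      have ih := readout_iterate_G x b us' (pre ++ [f u])
        { s with fAns := s.fAns ++ [f u], u := [], nAns := [],
                 rest := (((us'.flatMap fun u => N.queries O kN u).take (j - vs.length)).map O),
                 pad := s.pad - (vs.length + 2) } (j - vs.length) T'
        (fun i hi => by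
          have h1 := hstep (i + 1) (by simpa using hi)
          rw [List.getElem_cons_succ] at h1
          simpa [List.take_succ_cons, List.append_assoc] using h1)
        (by simpa [List.append_assoc] using hout)
        (fun u' hu' => hN u' (by simp [hu'])) (fun u' hu' => hub u' (by simp [hu']))
        (fun u' hu' => hqb u' (by simp [hu']))
        (fun i hi hsum => by
          have h1 := hfb (i + 1) (by simpa using hi)
            (by simpa [List.take_succ_cons, hq] using Nat.add_le_of_le_sub' hjv hsum)
          rwa [List.getElem_cons_succ] at h1)
        (fun hsum => hb (by simpa [hq] using Nat.add_le_of_le_sub' hjv hsum))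
        hph hx (by simp [hf]) rfl (by omega) (by simp only; omega) (by omega)
      rw [ih]
      by_cases hj' : j - vs.length < (us'.flatMap fun u => N.queries O kN u).length
      · rw [dif_pos hj', dif_pos (by omega)]
        congr 1
        rw [List.getElem_append_right (by omega)]
      · rw [dif_neg hj', dif_neg (by omega)]

/-- **Specification of the composite step function.** With the notation of
`readout_iterate_G` and `Q = us.flatMap (N.queries O kN ·)`: on input `x` and the answers of `O`
to the first `j ≤ |Q|` queries of `Q`, the step function of `compose M N eb prm` reports the
query `Q[j]` (if `j < |Q|`) or the output `b` of `M` (if `j = |Q|`), provided the parameters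
`prm` give, on this input, a clamp bound dominating the strings involved, fuel
`≥ Σ (|N.queries O kN u| + 2) + 1` and `≥ Σ (|N.queries O kN u| + 1) + 1` micro-steps.
[Ladner–Lynch–Selman 1975, §2; Arora–Barak 2009, §3.4] [cite: LadnerLynchSelman1975, §2] -/
theorem compose_step_eq (prm : Params) (x : List Bool) (b : β) (us : List (List Bool))
    (hstep : ∀ (i : ℕ) (hi : i < us.length), M.step x ((us.take i).map f) = Sum.inl (us[i]))
    (hout : M.step x (us.map f) = Sum.inr b) (hN : ∀ u ∈ us, N.run O kN u = some (f u))
    (j : ℕ) (hj : j ≤ (us.flatMap fun u => N.queries O kN u).length) {n : ℕ}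
    (hn : n = inputLength x (((us.flatMap fun u => N.queries O kN u).take j).map O))
    (hub : ∀ u ∈ us, u.length ≤ prm.bndOf n)
    (hqb : ∀ u ∈ us, ∀ q ∈ N.queries O kN u, q.length ≤ prm.bndOf n)
    (hfb : ∀ (i : ℕ) (hi : i < us.length),
      ((us.take (i + 1)).map fun u => (N.queries O kN u).length).sum ≤ j →
        (f (us[i])).length ≤ prm.bndOf n)
    (hb : ((us.map fun u => (N.queries O kN u).length).sum ≤ j) →
      (eb.encode b).length ≤ prm.bndOf n)
    (hpad : (us.map fun u => (N.queries O kN u).length + 2).sum + 1 ≤ prm.padOf n)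
    (hT : (us.map fun u => (N.queries O kN u).length + 1).sum + 1 ≤ prm.iterOf n) :
    (compose M N eb prm).step x (((us.flatMap fun u => N.queries O kN u).take j).map O) =
      if h : j < (us.flatMap fun u => N.queries O kN u).length then
        Sum.inl ((us.flatMap fun u => N.queries O kN u)[j]) else Sum.inr b := by
  subst hn
  exact readout_iterate_G O f kN x b us [] (initState prm x _) j _ (by simpa using hstep)
    (by simpa using hout) hN hub hqb hfb hb rfl rfl rfl rfl hj hpad hT

/-- **The composite algorithm computes `M^f` with oracle `O`.** Under the hypotheses of
`compose_step_eq` for every `j ≤ |Q|`, a run of `compose M N eb prm` with oracle `O` and fuel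
`> |Q|` returns the output `b` of `M` with oracle `f`, and its transcript is `Q` (the queries of
`N` on the successive queries of `M`). [Ladner–Lynch–Selman 1975, §2; Baker–Gill–Solovay 1975,
§1] [cite: LadnerLynchSelman1975, §2] -/
theorem compose_runAux_eq (prm : Params) (x : List Bool) (b : β) (us : List (List Bool))
    (hstep : ∀ (i : ℕ) (hi : i < us.length), M.step x ((us.take i).map f) = Sum.inl (us[i]))
    (hout : M.step x (us.map f) = Sum.inr b) (hN : ∀ u ∈ us, N.run O kN u = some (f u))
    (hprm : ∀ j ≤ (us.flatMap fun u => N.queries O kN u).length, ∀ n : ℕ,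
      n = inputLength x (((us.flatMap fun u => N.queries O kN u).take j).map O) →
      (∀ u ∈ us, u.length ≤ prm.bndOf n) ∧
      (∀ u ∈ us, ∀ q ∈ N.queries O kN u, q.length ≤ prm.bndOf n) ∧
      (∀ (i : ℕ) (hi : i < us.length),
        ((us.take (i + 1)).map fun u => (N.queries O kN u).length).sum ≤ j →
          (f (us[i])).length ≤ prm.bndOf n) ∧
      (((us.map fun u => (N.queries O kN u).length).sum ≤ j) →
        (eb.encode b).length ≤ prm.bndOf n) ∧
      (us.map fun u => (N.queries O kN u).length + 2).sum + 1 ≤ prm.padOf n ∧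
      (us.map fun u => (N.queries O kN u).length + 1).sum + 1 ≤ prm.iterOf n)
    {K : ℕ} (hK : (us.flatMap fun u => N.queries O kN u).length < K) :
    (compose M N eb prm).runAux O x K [] = some b ∧
      (compose M N eb prm).queriesAux O x K [] = us.flatMap fun u => N.queries O kN u := by
  refine (compose M N eb prm).runAux_of_trace O x _ [] b K (fun i hi => ?_) ?_ hK
  · obtain ⟨h1, h2, h3, h4, h5, h6⟩ := hprm i hi.le _ rfl
    rw [List.nil_append, compose_step_eq O f kN prm x b us hstep hout hN i hi.le rfl h1 h2 h3 h4 h5 h6,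
      dif_pos hi]
  · obtain ⟨h1, h2, h3, h4, h5, h6⟩ := hprm _ le_rfl _ rfl
    have := compose_step_eq O f kN prm x b us hstep hout hN _ le_rfl rfl h1 h2 h3 h4 h5 h6
    rw [List.take_length] at this
    rw [List.nil_append, this, dif_neg (lt_irrefl _)]

end Spec

/-! ### Length bookkeeping for the transcript encoding -/

section Lengths

/-- Length of the nested-pair body of the `listBool` code. [folklore] -/
theorem length_foldr_boolPair (l : List (List Bool)) :
    (l.foldr (fun a acc => boolPair a acc) []).length = (l.map fun a => 2 * a.length + 2).sum := by
  induction l with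
  | nil => rfl
  | cons a l ih => simp [ih]

/-- **Length of the `listBool` code of a transcript**: `2|l| + 2 + Σ (2|aᵢ| + 2)`.
[H21 design C2] [folklore] -/
theorem length_listBool_encode (l : List (List Bool)) :
    ((encodingList Bool).listBool.encode l).length =
      2 * l.length + 2 + (l.map fun a => 2 * a.length + 2).sum := by
  have hlen : ∀ n : ℕ, (unaryEncodeNat n).length = n := by
    intro n
    induction n with
    | zero => rfl
    | succ n ih => simp [unaryEncodeNat, ih]
  change (boolPair (unaryEncodeNat l.length) (l.foldr (fun a acc => boolPair a acc) [])).length = _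
  rw [length_boolPair, hlen, length_foldr_boolPair]

/-- The `listBool` code is monotone under sublists. [folklore] -/
theorem length_listBool_encode_le_of_sublist {l₁ l₂ : List (List Bool)} (h : l₁.Sublist l₂) :
    ((encodingList Bool).listBool.encode l₁).length ≤
      ((encodingList Bool).listBool.encode l₂).length := by
  rw [length_listBool_encode, length_listBool_encode]
  have h1 := h.length_le
  have h2 : (l₁.map fun a => 2 * a.length + 2).sum ≤ (l₂.map fun a => 2 * a.length + 2).sum :=
    (h.map _).sum_le_sum (fun _ _ => Nat.zero_le _)
  omega

/-- A sum of lengths bounded term by term. [folklore] -/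
theorem sum_map_le_length_mul {α : Type} (l : List α) (g : α → ℕ) (F : ℕ) (h : ∀ a ∈ l, g a ≤ F) :
    (l.map g).sum ≤ l.length * F := by
  induction l with
  | nil => simp
  | cons a l ih =>
    simp only [List.map_cons, List.sum_cons, List.length_cons, Nat.succ_mul]
    have := h a (by simp)
    have := ih fun a ha => h a (by simp [ha])
    omega

/-- The block of the `i`-th item of a `flatMap` lies within the first `j` elements as soon as
the first `i + 1` blocks have total length `≤ j`. [folklore] -/
theorem sublist_take_flatMap {α γ : Type} (us : List α) (g : α → List γ) (i j : ℕ)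
    (hi : i < us.length) (hj : ((us.take (i + 1)).map fun u => (g u).length).sum ≤ j) :
    (g (us[i])).Sublist ((us.flatMap g).take j) := by
  have h1 : (g (us[i])).Sublist ((us.take (i + 1)).flatMap g) := by
    have : [us[i]].Sublist (us.take (i + 1)) :=
      List.singleton_sublist.2 (List.mem_take_iff_getElem.2 ⟨i, by simp; omega, rfl⟩)
    simpa using this.flatMap g
  have h2 : ((us.take (i + 1)).flatMap g) <+: (us.flatMap g) := (List.take_prefix _ _).flatMap g
  have h3 : ((us.take (i + 1)).flatMap g) <+: ((us.flatMap g).take j) := by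
    rw [List.prefix_iff_eq_take] at h2
    rw [h2, List.length_flatMap]
    refine ⟨((us.flatMap g).take j).drop ((us.take (i + 1)).map fun u => (g u).length).sum, ?_⟩
    conv_rhs => rw [← List.take_append_drop ((us.take (i + 1)).map fun u => (g u).length).sum
      ((us.flatMap g).take j)]
    rw [List.take_take, min_eq_left hj]
  exact h1.trans h3.sublist

/-- `inputLength x ans = 2|x| + 2 + |listBool.encode ans|`. [folklore] -/
theorem inputLength_eq (x : List Bool) (ans : List (List Bool)) :
    inputLength x ans = 2 * x.length + 2 + ((encodingList Bool).listBool.encode ans).length := by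
  simp [inputLength]

end Lengths

end OracleComposition

namespace OracleAlg

variable {β : Type}

/-- **Output-length bound of a polynomial-time step function**: the code of the next
query/output has length polynomial in the length of the code of (input, answers).
[Arora–Barak 2009, §1.2 (a machine writes at most one symbol per step)] [cite: AroraBarak2009, §1.2] -/
theorem IsPolyTime.exists_length_le {M : OracleAlg β} {eb : Encoding β Bool}
    (h : M.IsPolyTime eb) : ∃ R : Polynomial ℕ, ∀ (x : List Bool) (ans : List (List Bool)),
      (((encodingList Bool).sumBool eb).encode (M.step x ans)).length ≤
        R.eval (boolPair x ((encodingList Bool).listBool.encode ans)).length := by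
  obtain ⟨p, T, hT⟩ := h
  refine ⟨Polynomial.X + Polynomial.C (TM2Comp.machinePushBound T.tm) * p, fun x ans => ?_⟩
  have := (hT (x, ans)).length_le
  simpa [Function.uncurry] using this

/-- **Named fact: the composite of two polynomial-time oracle algorithms is polynomial-time.**
For polynomial-time step functions `M`, `N` and every polynomial `P` there are resource
parameters dominating `P` (clamp bound, fuel and number of micro-steps all `≥ P(n)` on inputs
of length `n`) for which the step function of the composite machine
`OracleComposition.compose M N eb prm` — a clocked iteration of "run `M` one step, run `N` one
step" on a polynomially padded work tape — is polynomial-time computable in the transcript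
model of `Oracle.lean`. This is the machine-construction half of "polynomial-time oracle
machines compose" (the bookkeeping half is `OracleComposition.compose_runAux_eq`); it is
discharged in `OracleCompositionMachine.lean` from the tree's `FinTM2` toolkit.
[Arora–Barak 2009, §3.4 with Claim 1.6 / proof of Thm. 2.8 (polynomial-time computations
compose); Ladner–Lynch–Selman 1975, §2] [cite: AroraBarak2009, §3.4] -/
def isPolyTime_compose : Prop :=
  ∀ (β : Type) (eb : Encoding β Bool) (M : OracleAlg β) (N : OracleAlg (List Bool)),
    M.IsPolyTime eb → N.IsPolyTime (encodingList Bool) → ∀ P : Polynomial ℕ,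
      ∃ prm : OracleComposition.Params,
        (∀ n, P.eval n ≤ prm.bndOf n ∧ P.eval n ≤ prm.padOf n ∧ P.eval n ≤ prm.iterOf n) ∧
        (OracleComposition.compose M N eb prm).IsPolyTime eb

/-- **Composition of polynomial-time oracle algorithms** (master form). If `M` with the
intermediate oracle `f` computes `g` within `qM |x|` rounds with queries of length `≤ qM |x|`,
`M` is polynomial-time, and `f ∈ FP^O`, then some polynomial-time oracle algorithm with oracle
`O` computes `g` within polynomially many rounds with polynomially long queries — namely the
composite machine answering each query of `M` by running the `FP^O`-machine for `f`
("polynomials compose"). Conditional on the machine fact `isPolyTime_compose`.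
[Ladner–Lynch–Selman 1975, §2 (transitivity of `≤ᵀᴾ`); Arora–Barak 2009, §3.4]
[cite: LadnerLynchSelman1975, §2] -/
theorem exists_polyTime_of_mem_FPRel (hcomp : isPolyTime_compose) {eb : Encoding β Bool}
    {O f : Oracle} {g : List Bool → β} {M : OracleAlg β} (hM : M.IsPolyTime eb)
    {qM : Polynomial ℕ}
    (hMrun : ∀ x, M.run f (qM.eval x.length) x = some (g x) ∧
      ∀ y ∈ M.queries f (qM.eval x.length) x, y.length ≤ qM.eval x.length)
    (hf : f ∈ FPRel O) :
    ∃ C : OracleAlg β, C.IsPolyTime eb ∧ ∃ q : Polynomial ℕ, ∀ x,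
      C.run O (q.eval x.length) x = some (g x) ∧
        ∀ y ∈ C.queries O (q.eval x.length) x, y.length ≤ q.eval x.length := by
  classical
  obtain ⟨N, hN, qN, hNrun⟩ := hf
  obtain ⟨RM, hRM⟩ := hM.exists_length_le
  obtain ⟨RN, hRN⟩ := hN.exists_length_le
  -- the bounding polynomials (in the input length `n ≥ |x|` of the composite step function)
  let Kq : Polynomial ℕ := qN.comp qM
  let E : Polynomial ℕ := 2 * qM + 2 + Polynomial.X
  let F : Polynomial ℕ := RN.comp E
  let Lb : Polynomial ℕ := 2 * qM + 2 + qM * (2 * F + 2)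
  let B : Polynomial ℕ := RM.comp (2 * Polynomial.X + 2 + Lb)
  let Pd : Polynomial ℕ := qM * (Kq + 2) + 1
  let P : Polynomial ℕ := qM + Kq + F + B + Pd
  obtain ⟨prm, hprm, hC⟩ := hcomp β eb M N hM hN P
  refine ⟨OracleComposition.compose M N eb prm, hC, qM * Kq + Kq + 1, fun x => ?_⟩
  set m := x.length with hm
  -- the trace of `M` with oracle `f` on `x`
  obtain ⟨us, huslen, hstep, hout, hus⟩ :=
    M.exists_trace_of_runAux f x (qM.eval m) [] (g x) (hMrun x).1
  simp only [List.nil_append] at hstep hout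
  have hub : ∀ u ∈ us, u.length ≤ qM.eval m := fun u hu =>
    (hMrun x).2 u (by rw [OracleAlg.queries, hus]; exact hu)
  -- `N` computes `f` on every query of `M`, within `kN` rounds
  set kN := Kq.eval m with hkN
  have hkN' : ∀ u ∈ us, qN.eval u.length ≤ kN := fun u hu => by
    rw [hkN]; simpa [Kq] using TM2Iter.eval_mono qN (hub u hu)
  have hNrun' : ∀ u ∈ us, N.run O kN u = some (f u) := fun u hu =>
    N.run_mono O u (hkN' u hu) (hNrun u).1
  have hNq : ∀ u ∈ us, ∀ q ∈ N.queries O kN u, q.length ≤ kN := fun u hu q hq => by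
    have heq : N.queries O kN u = N.queries O (qN.eval u.length) u :=
      N.queriesAux_eq_of_runAux_eq_some O u (hkN' u hu) (hNrun u).1
    rw [heq] at hq
    exact ((hNrun u).2 q hq).trans (hkN' u hu)
  have hvlen : ∀ u ∈ us, (N.queries O kN u).length < kN := fun u hu => by
    obtain ⟨ws, hw, -, -, hws⟩ := N.exists_trace_of_runAux O u kN [] (f u) (hNrun' u hu)
    rw [OracleAlg.queries, hws]; exact hw
  -- size of the global query sequence
  have hQlen : (us.flatMap fun u => N.queries O kN u).length ≤ qM.eval m * kN := by
    rw [List.length_flatMap]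
    exact (OracleComposition.sum_map_le_length_mul us _ kN fun u hu => (hvlen u hu).le).trans
      (Nat.mul_le_mul_right _ huslen.le)
  have hK : (us.flatMap fun u => N.queries O kN u).length < (qM * Kq + Kq + 1).eval m := by
    simp only [Polynomial.eval_add, Polynomial.eval_mul, Polynomial.eval_one, ← hkN]
    nlinarith [hQlen]
  -- the run of the composite machine
  have hrun := OracleComposition.compose_runAux_eq (eb := eb) O f kN prm x (g x) us hstep hout
    hNrun' ?_ hK
  · refine ⟨hrun.1, fun y hy => ?_⟩
    rw [OracleAlg.queries, hrun.2, List.mem_flatMap] at hy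
    obtain ⟨u, hu, hy⟩ := hy
    have := hNq u hu y hy
    simp only [Polynomial.eval_add, Polynomial.eval_mul, Polynomial.eval_one, ← hkN]
    nlinarith
  -- the resource parameters suffice at every stage `j`
  intro j hj n hn
  have hmn : m ≤ n := by rw [hn, OracleComposition.inputLength_eq]; omega
  have hansn : ((encodingList Bool).listBool.encode
      (((us.flatMap fun u => N.queries O kN u).take j).map O)).length ≤ n := by
    rw [hn, OracleComposition.inputLength_eq]; omega
  have hPb : P.eval n ≤ prm.bndOf n := (hprm n).1
  have hPeval : P.eval n = qM.eval n + Kq.eval n + F.eval n + B.eval n + Pd.eval n := by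
    simp [P]
  have hA : qM.eval m ≤ qM.eval n := TM2Iter.eval_mono qM hmn
  have hKq : kN ≤ Kq.eval n := by rw [hkN]; exact TM2Iter.eval_mono Kq hmn
  -- (3) answers of `f` to completed queries
  have hfb : ∀ (i : ℕ) (hi : i < us.length),
      ((us.take (i + 1)).map fun u => (N.queries O kN u).length).sum ≤ j →
        (f (us[i])).length + 1 ≤ F.eval n := by
    intro i hi hsum
    set u := us[i] with hu_def
    have hu : u ∈ us := List.getElem_mem hi
    obtain ⟨ws, -, -, hwo, hws⟩ := N.exists_trace_of_runAux O u kN [] (f u) (hNrun' u hu)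
    simp only [List.nil_append] at hwo
    have hws' : N.queries O kN u = ws := hws
    -- the answers fed to `N` on `u` are among the available answers
    have hsub : (ws.map O).Sublist (((us.flatMap fun u => N.queries O kN u).take j).map O) := by
      rw [← hws']
      exact (OracleComposition.sublist_take_flatMap us (fun u => N.queries O kN u) i j hi hsum).map O
    have h1 := hRN u (ws.map O)
    rw [hwo] at h1
    have h2 : (boolPair u ((encodingList Bool).listBool.encode (ws.map O))).length ≤ E.eval n := by
      rw [length_boolPair]
      have := OracleComposition.length_listBool_encode_le_of_sublist hsub
      have := hub u hu
      have hA' : qM.eval m ≤ qM.eval n := TM2Iter.eval_mono qM hmn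
      simp only [E, Polynomial.eval_add, Polynomial.eval_mul, Polynomial.eval_ofNat,
        Polynomial.eval_X]
      omega
    have h3 : RN.eval (boolPair u ((encodingList Bool).listBool.encode (ws.map O))).length ≤
        F.eval n := by
      simp only [F, Polynomial.eval_comp]
      exact TM2Iter.eval_mono RN h2
    have h4 : (((encodingList Bool).sumBool (encodingList Bool)).encode
        (Sum.inr (f u) : List Bool ⊕ List Bool)).length = (f u).length + 1 := by
      simp [Encoding.sumBool, encodingList]
    omega
  refine ⟨fun u hu => (hub u hu).trans (hA.trans (by omega)),
    fun u hu q hq => (hNq u hu q hq).trans (hKq.trans (by omega)),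
    fun i hi hsum => by have := hfb i hi hsum; omega, fun hsum => ?_, ?_, ?_⟩
  · -- (4) the output of `M`
    have hall : ∀ (i : ℕ) (hi : i < us.length), (f (us[i])).length + 1 ≤ F.eval n := by
      intro i hi
      refine hfb i hi ((List.Sublist.sum_le_sum ?_ (fun _ _ => Nat.zero_le _)).trans hsum)
      exact (List.take_sublist _ _).map _
    have hLb : ((encodingList Bool).listBool.encode (us.map f)).length ≤ Lb.eval n := by
      rw [OracleComposition.length_listBool_encode, List.length_map, List.map_map]
      have hs : (us.map ((fun a : List Bool => 2 * a.length + 2) ∘ f)).sum ≤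
          us.length * (2 * F.eval n + 2) := by
        refine OracleComposition.sum_map_le_length_mul us _ _ fun u hu => ?_
        obtain ⟨i, hi, rfl⟩ := List.getElem_of_mem hu
        have := hall i hi
        simp only [Function.comp_apply]
        omega
      have hl : us.length * (2 * F.eval n + 2) ≤ qM.eval n * (2 * F.eval n + 2) :=
        Nat.mul_le_mul_right _ (huslen.le.trans hA)
      simp only [Lb, Polynomial.eval_add, Polynomial.eval_mul, Polynomial.eval_ofNat]
      omega
    have h1 := hRM x (us.map f)
    rw [hout] at h1
    have h2 : (boolPair x ((encodingList Bool).listBool.encode (us.map f))).length ≤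
        (2 * Polynomial.X + 2 + Lb).eval n := by
      rw [length_boolPair]
      simp only [Polynomial.eval_add, Polynomial.eval_mul, Polynomial.eval_ofNat, Polynomial.eval_X]
      omega
    have h3 := TM2Iter.eval_mono RM h2
    have h4 : (((encodingList Bool).sumBool eb).encode (Sum.inr (g x) : List Bool ⊕ β)).length =
        (eb.encode (g x)).length + 1 := by
      simp [Encoding.sumBool]
    have hB : B.eval n = RM.eval ((2 * Polynomial.X + 2 + Lb).eval n) := by
      simp only [B, Polynomial.eval_comp]
    omega
  · -- (5) fuel
    have h1 : (us.map fun u => (N.queries O kN u).length + 2).sum ≤ us.length * (kN + 2) :=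
      OracleComposition.sum_map_le_length_mul us _ _ fun u hu => by have := hvlen u hu; omega
    have h2 : us.length * (kN + 2) ≤ qM.eval n * (Kq.eval n + 2) :=
      Nat.mul_le_mul (huslen.le.trans hA) (by omega)
    have h3 : Pd.eval n ≤ prm.padOf n := by
      have := (hprm n).2.1; rw [hPeval] at this; omega
    simp only [Pd, Polynomial.eval_add, Polynomial.eval_mul, Polynomial.eval_ofNat,
      Polynomial.eval_one] at h3
    omega
  · -- (6) micro-steps
    have h1 : (us.map fun u => (N.queries O kN u).length + 1).sum ≤ us.length * (kN + 2) :=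
      OracleComposition.sum_map_le_length_mul us _ _ fun u hu => by have := hvlen u hu; omega
    have h2 : us.length * (kN + 2) ≤ qM.eval n * (Kq.eval n + 2) :=
      Nat.mul_le_mul (huslen.le.trans hA) (by omega)
    have h3 : Pd.eval n ≤ prm.iterOf n := by
      have := (hprm n).2.2; rw [hPeval] at this; omega
    simp only [Pd, Polynomial.eval_add, Polynomial.eval_mul, Polynomial.eval_ofNat,
      Polynomial.eval_one] at h3
    omega

/-! ### Changing the output presentation of an oracle algorithm -/

/-- Post-composing the outputs of an oracle algorithm with a map `φ` (queries unchanged).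
[folklore] -/
def mapOut {γ : Type} (M : OracleAlg β) (φ : β → γ) : OracleAlg γ where
  step x ans := (M.step x ans).map id φ

/-- Runs of `M.mapOut φ` are the runs of `M` with outputs mapped by `φ`. [folklore] -/
theorem runAux_mapOut {γ : Type} (M : OracleAlg β) (φ : β → γ) (O : Oracle) (x : List Bool) :
    ∀ (k : ℕ) (pre : List (List Bool)),
      (M.mapOut φ).runAux O x k pre = (M.runAux O x k pre).map φ
  | 0, pre => rfl
  | k + 1, pre => by
    rw [runAux_succ, runAux_succ]
    simp only [mapOut]
    cases M.step x pre with
    | inl q => simpa [mapOut] using runAux_mapOut M φ O x k (pre ++ [O q])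
    | inr b => rfl

/-- `M.mapOut φ` asks the same queries as `M`. [folklore] -/
theorem queriesAux_mapOut {γ : Type} (M : OracleAlg β) (φ : β → γ) (O : Oracle) (x : List Bool) :
    ∀ (k : ℕ) (pre : List (List Bool)),
      (M.mapOut φ).queriesAux O x k pre = M.queriesAux O x k pre
  | 0, pre => rfl
  | k + 1, pre => by
    simp only [queriesAux, mapOut]
    cases M.step x pre with
    | inl q => simpa [mapOut] using queriesAux_mapOut M φ O x k (pre ++ [O q])
    | inr b => rfl

/-- If `φ` does not change the output *codes*, `M.mapOut φ` is polynomial-time when `M` is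
(same machine). [folklore] -/
theorem IsPolyTime.mapOut {γ : Type} {M : OracleAlg β} {eb : Encoding β Bool}
    {ec : Encoding γ Bool} (h : M.IsPolyTime eb) (φ : β → γ)
    (hφ : ∀ b, ec.encode (φ b) = eb.encode b) : (M.mapOut φ).IsPolyTime ec := by
  obtain ⟨p, T, hT⟩ := h
  refine ⟨p, T, fun a => ?_⟩
  have h1 := hT a
  have h2 : ((encodingList Bool).sumBool ec).encode (Function.uncurry (M.mapOut φ).step a) =
      ((encodingList Bool).sumBool eb).encode (Function.uncurry M.step a) := by
    obtain ⟨x, ans⟩ := a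
    simp only [Function.uncurry, OracleAlg.mapOut]
    cases M.step x ans with
    | inl q => rfl
    | inr b => simp [Encoding.sumBool, hφ]
  rw [h2]
  exact h1

/-- **The oracle of a language of `P^O` is a function of `FP^O`** (output the one-symbol code
of the answer bit). [Baker–Gill–Solovay 1975, §1] [cite: BakerGillSolovay1975, §1] -/
theorem ofLanguage_mem_FPRel_of_mem_PRel {O : Oracle} {A : Language Bool} (hA : A ∈ PRel O) :
    Oracle.ofLanguage A ∈ FPRel O := by
  obtain ⟨M, hM, q, hrun⟩ := hA
  refine ⟨M.mapOut encodeBool, hM.mapOut encodeBool (fun b => rfl), q, fun x => ⟨?_, ?_⟩⟩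
  · change (M.mapOut encodeBool).runAux O x _ [] = _
    rw [runAux_mapOut]
    change (M.run O _ x).map encodeBool = _
    rw [(hrun x).1]
    rfl
  · intro y hy
    change y ∈ (M.mapOut encodeBool).queriesAux O x _ [] at hy
    rw [queriesAux_mapOut] at hy
    exact (hrun x).2 y hy

/-! ### Closure theorems, conditional on `isPolyTime_compose` -/

/-- **`f ∈ FP^O ⟹ P^f ⊆ P^O`** (conditional form of the named fact
`Literature.Computability.QuantumComplexity.PRel_subset_PRel_of_mem_FPRel`; Arora–Barak 2009, §3.4 with Claim 1.6).
[Ladner–Lynch–Selman 1975, §2; Arora–Barak 2009, §3.4] [cite: LadnerLynchSelman1975, §2] -/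
theorem PRel_subset_PRel_of_mem_FPRel_of (hcomp : isPolyTime_compose) (O f : Oracle)
    (hf : f ∈ FPRel O) : PRel f ⊆ PRel O := by
  intro L hL
  obtain ⟨M, hM, qM, hMrun⟩ := hL
  obtain ⟨C, hC, q, hCrun⟩ :=
    exists_polyTime_of_mem_FPRel (g := L.boolIndicator) hcomp hM hMrun hf
  exact ⟨C, hC, q, hCrun⟩

/-- **`f ∈ FP^O ⟹ FP^f ⊆ FP^O`** (function classes compose likewise).
[Ladner–Lynch–Selman 1975, §2; Arora–Barak 2009, §17.2 (`FP^{#P}`)] [cite: LadnerLynchSelman1975, §2] -/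
theorem FPRel_subset_FPRel_of_mem_FPRel_of (hcomp : isPolyTime_compose) (O f : Oracle)
    (hf : f ∈ FPRel O) : FPRel f ⊆ FPRel O := by
  intro g hg
  obtain ⟨M, hM, qM, hMrun⟩ := hg
  obtain ⟨C, hC, q, hCrun⟩ := exists_polyTime_of_mem_FPRel (g := g) hcomp hM hMrun hf
  exact ⟨C, hC, q, hCrun⟩

/-- **`P^{P^O} = P^O`** (conditional form of `mem_PRel_of_polyTimeTuringReducible` of
`Oracle.lean`): `L ≤ᵀₚ A → A ∈ P^O → L ∈ P^O`. [Ladner–Lynch–Selman 1975, §2;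
Baker–Gill–Solovay 1975, §1] [cite: LadnerLynchSelman1975, §2] -/
theorem mem_PRel_of_polyTimeTuringReducible_of (hcomp : isPolyTime_compose) :
    mem_PRel_of_polyTimeTuringReducible := fun h hA =>
  PRel_subset_PRel_of_mem_FPRel_of hcomp _ _ (ofLanguage_mem_FPRel_of_mem_PRel hA) h

/-- **Transitivity of polynomial-time Turing reducibility** (conditional form of
`polyTimeTuringReducible_trans` of `Oracle.lean`). [Ladner–Lynch–Selman 1975, §2]
[cite: LadnerLynchSelman1975, §2] -/
theorem polyTimeTuringReducible_trans_of (hcomp : isPolyTime_compose) :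
    polyTimeTuringReducible_trans := fun h₁₂ h₂₃ =>
  mem_PRel_of_polyTimeTuringReducible_of hcomp h₁₂ h₂₃

end OracleAlg

end Literature.Computability.Complexity
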